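import Mathlib
import Literature.NumberTheory.EllipticCurves.Newforms
import Literature.NumberTheory.Automorphic.BrandtDefiniteSetupLite

/-!
# Layer-2 fact F1 for `stub_uniformToricControl` (crux `VerticalSelmerBound`, stmt-BirchSwinnertonDyer-18432, line `toric_control`):
# the Eichler / Jacquet–Langlands transfer in weight `k` for INLINE Brandt eigen-systems — PROPOSED STATEMENT (lead workfile)

Written by the continuation line lead prover-line-stmt-BirchSwinnertonDyer-18432-c1-0 (2026-08-17) as the checked, ready-to-file
form of fact (F1) of the PROMOTE dossier of `stub_uniformToricControl`. It is NOT filed under `Literature/` by this seat (nothing in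
the tree consumes it yet; a planner/definer files it together with the definition request D1 `Brandt.IsWeightEigenformLite`).

Statement (Eichler's basis problem / Jacquet–Langlands for definite quaternion algebras over `ℚ`, arbitrary weight):
let `B = (a,b)_ℚ` be definite, ramified exactly at the primes of the squarefree `N⁻`, `O ⊆ B` an Eichler order of level `N⁺`
(`(N⁺, N⁻) = 1`), and let `Φ` be a non-zero `Bˣ`-equivariant `Sym^(k-2)`-valued function on the invertible right `O`-ideals
(`Φ(βI) = ρ_β Φ(I)`, values homogeneous polynomials of degree `k - 2` over a number field `F` split by `ι : B → M₂(F)`), which is a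
`T_q`-eigenvector with eigenvalue `lam q ∈ F` for every prime `q ∤ N⁺N⁻` (`T_q` = sum over the `q + 1` right-`O`-stable sublattices of
index `q²`). Then for some divisor `M ∣ N⁺` there is a newform `g ∈ S_k(Γ₀(N⁻M))` and a field embedding `σ : F → ℂ` with
`a_q(g) = σ(lam q)` for all primes `q ∤ N⁺N⁻`.

Sources: M. Eichler, *The basis problem for modular forms and the traces of the Hecke operators*, LNM 320 (1973), Thm. p. 138
(squarefree level); H. Hijikata, A. Pizer, T. Shemanske, *The basis problem for modular forms on `Γ₀(N)`*, Mem. AMS 418 (1989),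
Thm. 7.10–7.12 (Eichler orders of level `N⁺` in the definite algebra of discriminant `N⁻`: `S_k(O) ≅ ⊕_{M ∣ N⁺} S_k(Γ₀(N⁻M))^{new}`
with multiplicities, as modules over the Hecke algebra generated by `T_q`, `q ∤ N`); H. Jacquet, R. Langlands, *Automorphic forms
on GL(2)*, LNM 114 (1970), Ch. 16; for the `Sym^(k-2)`-valued avatar on `B̂ˣ/Ôˣ`: M. Bertolini, H. Darmon, Invent. Math. 126 (1996) §1.1;
M. Chida, M.-L. Hsieh, J. reine angew. Math. 741 (2018) §2.3–§3.1.

Faithfulness notes. (i) The inline `T_q` is right translation by the double coset `Ôˣ diag(q,1) Ôˣ` (no coefficient action), the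
weight action is through `Bˣ` on the left — the convention of BD1996/CH2018, under which the eigen-systems of `S_k(O) ⊗ ℂ` are exactly
those of `⊕_{M ∣ N⁺} S_k(Γ₀(N⁻M))^{N⁻M-new}` for `T_q`, `q ∤ N` (for `k > 2` there is no Eisenstein/constant part). (ii) `Φ` is
`F`-rational, so its eigen-system is; for ANY `σ : F → ℂ`, `σ ∘ Φ` is a complex eigenvector with eigenvalues `σ(lam q)`, realised by
a newform `g` of level `N⁻M`; the statement only asserts `∃ σ`. (iii) `a_q(g)` is the `q`-th coefficient of the period-1
`q`-expansion (`T_q g = a_q(g) g`, tree fact `IsNewform0.heckeEigenvalue_eq_coeff`). (iv) The Brandt data are phrased with the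
tree's Mathlib-only package `Brandt.*Lite` (BrandtDefiniteSetupLite.lean), rfl-level equal to the crux's inline `let`s.
-/

noncomputable section

set_option linter.dupNamespace false

open scoped MatrixGroups ModularForm BigOperators
open CongruenceSubgroup

namespace Summit.BirchSwinnertonDyer.BirchSwinnertonDyer.Cruxes.VerticalSelmerBound.ToricControl.Layer2

open Literature.NumberTheory.Automorphic Literature.NumberTheory.EllipticCurves.ModularForms

/-- **(F1) Eichler–Jacquet–Langlands transfer in weight `k` for inline Brandt eigen-systems (PROPOSED named fact).**
For a definite set-up of type `(N⁺, N⁻)` (`Brandt.DefiniteSetupLite`), `N⁺ N⁻ ≠ 0` coprime, a splitting `ι : B → M₂(F)` over a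
number field `F`, a weight `k > 2`, eigenvalues `lam : ℕ → F` and a function `Φ` on `ℤ`-lattices of `B` with values in `F[X₀,X₁]`
which on the invertible right `O`-ideals is homogeneous of degree `k-2`, `Bˣ`-equivariant for the substitution action
`Brandt.coeffActionLite ι`, a `T_q`-eigenvector (`Σ_{J ∈ heckeNeighboursLite O q I} Φ J = lam q • Φ I`) for every prime
`q ∤ N⁺N⁻`, and non-zero: there are `M ∣ N⁺`, a newform `g ∈ S_k(Γ₀(N⁻ M))` and `σ : F →+* ℂ` with `a_q(g) = σ (lam q)` for all
primes `q ∤ N⁺N⁻`. [cite: HijikataPizerShemanske1989, Thm. 7.12] [cite: Eichler1973BasisProblem, Thm. 1]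
[cite: JacquetLanglands1970, Ch. 16] [file NumberTheory/Automorphic/BrandtWeightKJacquetLanglands] -/
def jacquetLanglands_newform_of_brandtEigenformLite : Prop :=
  ∀ (Nplus Nminus : ℕ) (S : Brandt.DefiniteSetupLite Nplus Nminus) (F : Type) [Field F] [NumberField F]
    (ι : QuaternionAlgebra ℚ S.a 0 S.b →ₐ[ℚ] Matrix (Fin 2) (Fin 2) F) (k : ℕ) (lam : ℕ → F)
    (Φ : Submodule ℤ (QuaternionAlgebra ℚ S.a 0 S.b) → MvPolynomial (Fin 2) F),
    Nplus ≠ 0 → Nat.Coprime Nplus Nminus → 2 < k →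
    (∀ I ∈ Brandt.rightIdealsLite S.O, (Φ I).IsHomogeneous (k - 2)) →
    (∀ (β : (QuaternionAlgebra ℚ S.a 0 S.b)ˣ), ∀ I ∈ Brandt.rightIdealsLite S.O,
        Φ (I.map (AddMonoidHom.mulLeft β.1).toIntLinearMap) = Brandt.coeffActionLite ι β (Φ I)) →
    (∀ q : ℕ, q.Prime → ¬ q ∣ Nplus * Nminus → ∀ I ∈ Brandt.rightIdealsLite S.O,
        ∑ᶠ J ∈ Brandt.heckeNeighboursLite S.O q I, Φ J = lam q • Φ I) →
    (∃ I ∈ Brandt.rightIdealsLite S.O, Φ I ≠ 0) →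
    ∃ (M : ℕ) (_ : NeZero (Nminus * M)) (g : CuspForm (Gamma0 (Nminus * M)) (k : ℤ)) (σ : F →+* ℂ),
      M ∣ Nplus ∧ IsNewform0 g ∧
      ∀ q : ℕ, q.Prime → ¬ q ∣ Nplus * Nminus → (UpperHalfPlane.qExpansion 1 ⇑g).coeff q = σ (lam q)

end Summit.BirchSwinnertonDyer.BirchSwinnertonDyer.Cruxes.VerticalSelmerBound.ToricControl.Layer2

end
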